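/-
COR-CM (cell pub-hodgecm2, stage 2 of the Hodge ladder) — junction B01, leaf B01-O = hM: the ABSTRACT TWIN of the meeting-form display
of record `Model.hc_cm_of_jointThetaPin_meeting_rec` (`CorCM/B01/FaceWedgeMeetJointMeeting.lean`:172, p292271) — item (iii)'s `L²`
carrier `HG`, embedding `emb` and Petersson-=-cup clause `inner_emb` quantified EXISTENTIALLY instead of pinned to `Lp ℂ 2 V.autMeasure` /
`Model.embOf` / `Model.embOf_inner_emb` — requested by the hM owner for the RED-TEAM STATEMENT-EQUALITY CHECK of COORDINATOR RULING —
HODGE VENUE 2026-08-21T19:05:27Z (1) (own-b01 «VENUE (b)+ COHERENCE» (J1), HOME/INBOX l.4951: the package discharges C5′/C6′ for ITS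
`T.emb`/`T.HG`, so a symbol-level equality needs the tree display abstract in `(HG, emb, inner_emb)`).  The per-face hypothesis of
`Model.hc_cm_of_thetaRealisation₂_abs_rec` below is, clause for clause, the hypothesis list of the PACKAGE constructor
`HodgeCM.Universe.ModelAxiomsPerL.nonempty_thetaRealisation₂_at` (PKG `HodgeCM/Model/EndStateMeet.lean`:353; h₂ `InnerEmbAt`, h₅ `Theta_sub`,
h₆ cohomological theta wedge, h₇ C5′ `gen12Meet`, h₈ C6′ `real34Meet`; h₉/h₁₀ `H_chars`/`H_occ` live inside the isolation setting `Siso` as in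
the package's `S := {core, t12, t34, H_chars, H_occ}`) with the package's `T.Λ Γ ω₁ ω₂ = T.emb Γ (ω₁ ∪ ω₂)` (`Automorphic/ThetaModel.lean`:159–165)
spelled `emb Γ (U.cup2C _ 1 ω₁ ω₂)`; `Model.hc_cm_of_jointThetaPin_meeting_abs_rec` is p292271 VERBATIM with `(HG, emb, inner_emb)` abstract.
AUTHORED AND FILED by seat prover-pub-hodgecm2-b01-x1-g3-0 (b01-x1 gen 3), 2026-08-21 (lane `CorCM/B01/FaceWedgeMeet*.lean`, lead NAMING
RULING l.4194 (3)).  Theorems only: no `def`, no instance, no cite binder, nothing cited as a record, nothing asserted, no `sorry`;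
`Interfaces.lean` (C1), the E term, `Transposition/*` and the other `CorCM/B01/*` files untouched.
T5 (standing tribunal item, COORDINATOR RULING 2026-08-21T15:33:56Z (3)): the per-face binder sets of the displays below were submitted to
pub-hodgecm2-t5-consist-1 on the exact bytes before filing (HOME/INBOX; verdict line in HOME/T5-LEDGER.md, quoted in the filing note).
FRAMING (COORDINATOR RULING 2026-08-21T11:55:35Z): `HC_CM` is NOT proved; B01-O = hM is NOT proved in the tree (state word «discharged by
record» only after the red team's signed equality check); every per-face binder below is OPEN in the tree and inhabited by no one.
-/
import Summits.HodgeConjecture.CorCM.B01.FaceWedgeMeetJointMeeting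
import HarnessLib

/-!
# B01-O = hM, ABSTRACT meeting form: the tree display whose hypothesis IS the package's realisation-constructor input list

Tree engine = PKG `thm44_of_realisation₂` (`Transposition.IsolationSpans.periodNV_ofSetting_meet`, `Item5IsolationSpansHolds.lean`:281,
abstract in `HG`/`emb`).  Dictionary for the equality check (tree ↔ PKG `HodgeCM.…`, port rules R1–R5):
`emb Γ (U.cup2C _ 1 ω₁ ω₂)` ↔ `T.Λ Γ ω₁ ω₂` (`ThetaModel.Λ_apply`) · `Θ i Γ` ↔ `T.Theta V c i Γ` · `Siso` ↔
`{core := T.core V c, t12 := T.t12 V c, t34 := T.t34 V c, H_chars := h₉, H_occ := h₁₀}` · `F, f.psi, σ` ↔ `c.K, c.Ψ, c.σ` (face context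
`K = L = F`) · `inner_emb` ↔ `h₂ : T.InnerEmbAt V` · `Theta_sub` ↔ `h₅` · `wedge` ↔ `h₆` · `gen12Meet` ↔ `h₇` (tree: `∃ u ∈ Siso.t12.S12`,
verbatim the field `ThetaRealisation₂.gen12Meet` :141; the package's pointwise `Gen12MeetAt` :238 has `∃ χ Φ, … ϑ χ Φ` — stronger, fine) ·
`real34Meet` ↔ `h₈ = Real34MeetAt` :245 (verbatim, incl. the tree's extra guard `Siso.t34.allowed χ →`, which the package's all-characters
setting makes vacuous — weaker hypothesis, fine).  Universes (J0): tree `Model.picardCMUniverse hHD hI h₁ h₃` ↔ PKG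
`picardCMUniverse hHD hI h₁ (cmAbelianVarietyRealised_of_eigenbasis hHD hI h₃)`; `Universe.PeriodNV` / `PeriodThmF` are TEXT-IDENTICAL in
`CorCM/Geometry/Statements.lean` and PKG `Geometry/Statements.lean` (the tree adds `@[conjecture]` tags only).

Contents (namespace `Summit.HodgeConjecture.CorCM.Model`):
* `exists_periodNV_free_of_thetaRealisation₂_abs (hHD hI h₁ h₃) (h)` — free face-period witnesses from the abstract realisation inputs
  (line field in `L²` from the cohomological wedge by `inner_emb` + Hodge–Riemann (2,0), a tree theorem `universeOf_hodgeRiemann_pms`, exactly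
  as the package's `emb_ne_zero_at`; then `periodNV_ofSetting_meet`);
* `hc_cm_of_thetaRealisation₂_abs (hHD hI h₁ h₃) (hR) (h) : HC_CM`, `hc_cm_of_thetaRealisation₂_abs_rec (h) : HC_CM` (ONE hypothesis) —
  THE EQUALITY-CHECK TARGET;
* `hc_cm_of_jointThetaPin_meeting_abs_rec (h) : HC_CM` — p292271's display with `(HG, emb, inner_emb)` abstract (supply datum `S`,
  translate-closure, C5′, C6′), reduced to the former by `Transposition.Model.wedge_of_translateClosed_heckeFamily` (B01-H inside).
STRENGTH: abstract ⇒ pinned (instantiate `HG := Lp ℂ 2 V.autMeasure`, `emb := Model.embOf`, `inner_emb := Model.embOf_inner_emb`), so these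
displays are WEAKER hypotheses / STRONGER theorems than p292271; still PeriodNV-strength with `Siso` un-pinned (idea-2 IDEA-2u, b28 §X7).
-/

noncomputable section

open scoped TensorProduct InnerProductSpace

namespace Summit.HodgeConjecture.CorCM

open MeasureTheory
open Literature.AlgebraicGeometry.Motives (CMType HodgeStructure)
open Literature.AlgebraicGeometry.Motives.HodgeStructure (conj)
open Literature.AlgebraicGeometry.HodgeTheory
open Literature.NumberTheory.Automorphic
open Literature.NumberTheory.Automorphic.PicardCM
open Prior.Perl34File (Perl34.IsolationSetting)
open Prior.Perl34File.Perl34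

namespace Model

open Transposition

/-! ## §1  The package's realisation-constructor inputs, abstract in `(HG, emb)`, give free face-period witnesses -/

/-- **Free face-period witnesses from the ABSTRACT realisation inputs** (per face ∃ `ι₁ V σ`, an `L²` carrier `HG` with embedding
`emb` of `H²(P_Γ, ℂ)`, theta sets `Θ`, an isolation setting `Siso` over `HG`, and the five Prop clauses h₂ `inner_emb`, h₅ `Theta_sub`,
h₆ cohomological wedge, h₇ C5′ `gen12Meet`, h₈ C6′ `real34Meet` of PKG `nonempty_thetaRealisation₂_at`).  Proof = the package's: the
cohomological wedge is a non-zero `(2,0)`-class (`Universe.cup2C_mem_F_two_of_Uiso`), hence has non-zero `emb`-image by `inner_emb` and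
Hodge–Riemann (2,0) (`Transposition.emb_ne_zero_of_hodgeRiemann`, `universeOf_hodgeRiemann_pms`); then `IsolationSpans.periodNV_ofSetting_meet`.
[folklore] -/
theorem exists_periodNV_free_of_thetaRealisation₂_abs (hHD : exists_isReal_hodgeModel)
    (hI : hodgePQ_independent_of_hodgeModel) (h₁ : BallQuotientUniformised) (h₃ : CMAbelianVarietyRealised)
    (h : ∀ (F : CMField), IsGalois ℚ F → 6 ≤ Module.finrank ℚ F → ∀ f : Face F,
      ∃ (ι₁ : F →+* ℂ) (V : HermSpace3 F ι₁) (σ : F →+* ℂ)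
        (HG : Type) (_ : NormedAddCommGroup HG) (_ : InnerProductSpace ℂ HG) (_ : CompleteSpace HG)
        (emb : ∀ Γ : Level V, (picardCMUniverse hHD hI h₁ h₃).CohC ((picardCMUniverse hHD hI h₁ h₃).pms F ι₁ V Γ) 2 →ₗ[ℂ] HG)
        (Θ : Fin 4 → ∀ Γ : Level V, Set ((picardCMUniverse hHD hI h₁ h₃).CohC ((picardCMUniverse hHD hI h₁ h₃).pms F ι₁ V Γ) 1))
        (H CG G SK SigIdx SigIdxG : Type)
        (_ : NormedAddCommGroup H) (_ : InnerProductSpace ℂ H) (_ : CompleteSpace H)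
        (_ : NormedAddCommGroup CG) (_ : NormedSpace ℂ CG) (_ : Group G) (_ : TopologicalSpace G) (_ : TopologicalSpace SK)
        (Siso : Perl34.IsolationSetting H HG CG G SK SigIdx SigIdxG),
        (∀ Γ : Level V, ∃ c : ℂ, c ≠ 0 ∧
          ∀ x y : (picardCMUniverse hHD hI h₁ h₃).CohC ((picardCMUniverse hHD hI h₁ h₃).pms F ι₁ V Γ) 2,
            x ∈ ((picardCMUniverse hHD hI h₁ h₃).hodge ((picardCMUniverse hHD hI h₁ h₃).pms F ι₁ V Γ) 2).F 2 →
            y ∈ ((picardCMUniverse hHD hI h₁ h₃).hodge ((picardCMUniverse hHD hI h₁ h₃).pms F ι₁ V Γ) 2).F 2 →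
              ⟪emb Γ y, emb Γ x⟫_ℂ = c * (picardCMUniverse hHD hI h₁ h₃).trC ((picardCMUniverse hHD hI h₁ h₃).pms F ι₁ V Γ) 4
                ((picardCMUniverse hHD hI h₁ h₃).cup2C ((picardCMUniverse hHD hI h₁ h₃).pms F ι₁ V Γ) 2 x (conj y))) ∧
        (∀ (i : Fin 4) (Γ : Level V), Θ i Γ ⊆ (picardCMUniverse hHD hI h₁ h₃).Uiso Γ F (f.psi i) σ) ∧
        (∃ Γ : Level V, ∃ ω₁ ∈ Θ 0 Γ, ∃ ω₂ ∈ Θ 1 Γ,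
          (picardCMUniverse hHD hI h₁ h₃).cup2C ((picardCMUniverse hHD hI h₁ h₃).pms F ι₁ V Γ) 1 ω₁ ω₂ ≠ 0) ∧
        (∀ (Γ : Level V) (ω₁ ω₂ : (picardCMUniverse hHD hI h₁ h₃).CohC ((picardCMUniverse hHD hI h₁ h₃).pms F ι₁ V Γ) 1),
          ω₁ ∈ Θ 0 Γ → ω₂ ∈ Θ 1 Γ →
          emb Γ ((picardCMUniverse hHD hI h₁ h₃).cup2C ((picardCMUniverse hHD hI h₁ h₃).pms F ι₁ V Γ) 1 ω₁ ω₂) ≠ 0 →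
            ∃ u ∈ Siso.t12.S12,
              ⟪emb Γ ((picardCMUniverse hHD hI h₁ h₃).cup2C ((picardCMUniverse hHD hI h₁ h₃).pms F ι₁ V Γ) 1 ω₁ ω₂), u⟫_ℂ ≠ 0) ∧
        (∀ χ : Siso.t34.X, Siso.t34.allowed χ → ∀ (Φ : SK) (Γ₁ : Level V)
          (ω₁ ω₂ : (picardCMUniverse hHD hI h₁ h₃).CohC ((picardCMUniverse hHD hI h₁ h₃).pms F ι₁ V Γ₁) 1),
          ω₁ ∈ (picardCMUniverse hHD hI h₁ h₃).Uiso Γ₁ F (f.psi 0) σ →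
          ω₂ ∈ (picardCMUniverse hHD hI h₁ h₃).Uiso Γ₁ F (f.psi 1) σ →
            ⟪emb Γ₁ ((picardCMUniverse hHD hI h₁ h₃).cup2C ((picardCMUniverse hHD hI h₁ h₃).pms F ι₁ V Γ₁) 1 ω₁ ω₂),
              Siso.t34.ϑ χ Φ⟫_ℂ ≠ 0 →
              ∃ (Γ : Level V) (ω : Fin 4 → (picardCMUniverse hHD hI h₁ h₃).CohC ((picardCMUniverse hHD hI h₁ h₃).pms F ι₁ V Γ) 1),
                (∀ i, ω i ∈ (picardCMUniverse hHD hI h₁ h₃).Uiso Γ F (f.psi i) σ) ∧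
                ⟪emb Γ ((picardCMUniverse hHD hI h₁ h₃).cup2C ((picardCMUniverse hHD hI h₁ h₃).pms F ι₁ V Γ) 1 (ω 2) (ω 3)),
                  emb Γ ((picardCMUniverse hHD hI h₁ h₃).cup2C ((picardCMUniverse hHD hI h₁ h₃).pms F ι₁ V Γ) 1 (ω 0) (ω 1))⟫_ℂ
                  ≠ 0)) :
    ∀ (F : CMField), IsGalois ℚ F → 6 ≤ Module.finrank ℚ F → ∀ f : Face F,
      ∃ (ι₁ : F →+* ℂ) (V : HermSpace3 F ι₁) (σ : F →+* ℂ), (picardCMUniverse hHD hI h₁ h₃).PeriodNV ι₁ V F f.psi σ := by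
  intro F hG h6 f
  obtain ⟨ι₁, V, σ, HG, _, _, _, emb, Θ, H, CG, G, SK, SigIdx, SigIdxG, _, _, _, _, _, _, _, _, Siso,
    hinner, hsub, ⟨Γ₁, ω₁, hω₁, ω₂, hω₂, hne⟩, hg, hr⟩ := h F hG h6 f
  have hH := universeOf_fact_pull_hodge hHD hI (ballQuotientUniformisedDatum_of h₁) h₃
  have hcup2 := universeOf_fact_cup2_hodge hHD hI (ballQuotientUniformisedDatum_of h₁) h₃
  -- h₆ ⇒ the `L²` line field for `emb` (inner_emb + Hodge–Riemann (2,0)), as PKG `emb_ne_zero_at`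
  have hlf : ∃ (Γ : Level V), ∃ ω₁ ∈ Θ 0 Γ, ∃ ω₂ ∈ Θ 1 Γ,
      emb Γ ((picardCMUniverse hHD hI h₁ h₃).cup2C ((picardCMUniverse hHD hI h₁ h₃).pms F ι₁ V Γ) 1 ω₁ ω₂) ≠ 0 :=
    ⟨Γ₁, ω₁, hω₁, ω₂, hω₂, Transposition.emb_ne_zero_of_hodgeRiemann (emb Γ₁) (hinner Γ₁)
      (fun η hη h0 => universeOf_hodgeRiemann_pms hHD hI (ballQuotientUniformisedDatum_of h₁) h₃ V Γ₁ η hη h0)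
      (Universe.cup2C_mem_F_two_of_Uiso hH hcup2 Γ₁ F (f.psi 0) (f.psi 1) σ (hsub 0 Γ₁ hω₁) (hsub 1 Γ₁ hω₂)) hne⟩
  exact ⟨ι₁, V, σ, IsolationSpans.periodNV_ofSetting_meet hH hcup2 Siso hsub hlf hg hr hinner⟩

/-! ## §2  The displays -/

/-- **`HC_CM` from the ABSTRACT realisation inputs** (the package's `nonempty_thetaRealisation₂_at` hypothesis list per face, abstract in
`(HG, emb)`; `hR` = Hom-fullness, a tree theorem on the universe of record).  THE STATEMENT-EQUALITY TARGET of the venue-(b)+ ruling.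
`HC_CM` is NOT proved. [folklore] -/
theorem hc_cm_of_thetaRealisation₂_abs (hHD : exists_isReal_hodgeModel) (hI : hodgePQ_independent_of_hodgeModel)
    (h₁ : BallQuotientUniformised) (h₃ : CMAbelianVarietyRealised) (hR : DeligneMilne1982_Thm_6_20_full)
    (h : ∀ (F : CMField), IsGalois ℚ F → 6 ≤ Module.finrank ℚ F → ∀ f : Face F,
      ∃ (ι₁ : F →+* ℂ) (V : HermSpace3 F ι₁) (σ : F →+* ℂ)
        (HG : Type) (_ : NormedAddCommGroup HG) (_ : InnerProductSpace ℂ HG) (_ : CompleteSpace HG)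
        (emb : ∀ Γ : Level V, (picardCMUniverse hHD hI h₁ h₃).CohC ((picardCMUniverse hHD hI h₁ h₃).pms F ι₁ V Γ) 2 →ₗ[ℂ] HG)
        (Θ : Fin 4 → ∀ Γ : Level V, Set ((picardCMUniverse hHD hI h₁ h₃).CohC ((picardCMUniverse hHD hI h₁ h₃).pms F ι₁ V Γ) 1))
        (H CG G SK SigIdx SigIdxG : Type)
        (_ : NormedAddCommGroup H) (_ : InnerProductSpace ℂ H) (_ : CompleteSpace H)
        (_ : NormedAddCommGroup CG) (_ : NormedSpace ℂ CG) (_ : Group G) (_ : TopologicalSpace G) (_ : TopologicalSpace SK)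
        (Siso : Perl34.IsolationSetting H HG CG G SK SigIdx SigIdxG),
        (∀ Γ : Level V, ∃ c : ℂ, c ≠ 0 ∧
          ∀ x y : (picardCMUniverse hHD hI h₁ h₃).CohC ((picardCMUniverse hHD hI h₁ h₃).pms F ι₁ V Γ) 2,
            x ∈ ((picardCMUniverse hHD hI h₁ h₃).hodge ((picardCMUniverse hHD hI h₁ h₃).pms F ι₁ V Γ) 2).F 2 →
            y ∈ ((picardCMUniverse hHD hI h₁ h₃).hodge ((picardCMUniverse hHD hI h₁ h₃).pms F ι₁ V Γ) 2).F 2 →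
              ⟪emb Γ y, emb Γ x⟫_ℂ = c * (picardCMUniverse hHD hI h₁ h₃).trC ((picardCMUniverse hHD hI h₁ h₃).pms F ι₁ V Γ) 4
                ((picardCMUniverse hHD hI h₁ h₃).cup2C ((picardCMUniverse hHD hI h₁ h₃).pms F ι₁ V Γ) 2 x (conj y))) ∧
        (∀ (i : Fin 4) (Γ : Level V), Θ i Γ ⊆ (picardCMUniverse hHD hI h₁ h₃).Uiso Γ F (f.psi i) σ) ∧
        (∃ Γ : Level V, ∃ ω₁ ∈ Θ 0 Γ, ∃ ω₂ ∈ Θ 1 Γ,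
          (picardCMUniverse hHD hI h₁ h₃).cup2C ((picardCMUniverse hHD hI h₁ h₃).pms F ι₁ V Γ) 1 ω₁ ω₂ ≠ 0) ∧
        (∀ (Γ : Level V) (ω₁ ω₂ : (picardCMUniverse hHD hI h₁ h₃).CohC ((picardCMUniverse hHD hI h₁ h₃).pms F ι₁ V Γ) 1),
          ω₁ ∈ Θ 0 Γ → ω₂ ∈ Θ 1 Γ →
          emb Γ ((picardCMUniverse hHD hI h₁ h₃).cup2C ((picardCMUniverse hHD hI h₁ h₃).pms F ι₁ V Γ) 1 ω₁ ω₂) ≠ 0 →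
            ∃ u ∈ Siso.t12.S12,
              ⟪emb Γ ((picardCMUniverse hHD hI h₁ h₃).cup2C ((picardCMUniverse hHD hI h₁ h₃).pms F ι₁ V Γ) 1 ω₁ ω₂), u⟫_ℂ ≠ 0) ∧
        (∀ χ : Siso.t34.X, Siso.t34.allowed χ → ∀ (Φ : SK) (Γ₁ : Level V)
          (ω₁ ω₂ : (picardCMUniverse hHD hI h₁ h₃).CohC ((picardCMUniverse hHD hI h₁ h₃).pms F ι₁ V Γ₁) 1),
          ω₁ ∈ (picardCMUniverse hHD hI h₁ h₃).Uiso Γ₁ F (f.psi 0) σ →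
          ω₂ ∈ (picardCMUniverse hHD hI h₁ h₃).Uiso Γ₁ F (f.psi 1) σ →
            ⟪emb Γ₁ ((picardCMUniverse hHD hI h₁ h₃).cup2C ((picardCMUniverse hHD hI h₁ h₃).pms F ι₁ V Γ₁) 1 ω₁ ω₂),
              Siso.t34.ϑ χ Φ⟫_ℂ ≠ 0 →
              ∃ (Γ : Level V) (ω : Fin 4 → (picardCMUniverse hHD hI h₁ h₃).CohC ((picardCMUniverse hHD hI h₁ h₃).pms F ι₁ V Γ) 1),
                (∀ i, ω i ∈ (picardCMUniverse hHD hI h₁ h₃).Uiso Γ F (f.psi i) σ) ∧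
                ⟪emb Γ ((picardCMUniverse hHD hI h₁ h₃).cup2C ((picardCMUniverse hHD hI h₁ h₃).pms F ι₁ V Γ) 1 (ω 2) (ω 3)),
                  emb Γ ((picardCMUniverse hHD hI h₁ h₃).cup2C ((picardCMUniverse hHD hI h₁ h₃).pms F ι₁ V Γ) 1 (ω 0) (ω 1))⟫_ℂ
                  ≠ 0)) :
    HC_CM :=
  hc_cm_of_exists_facePeriod_free hHD hI h₁ h₃ (exists_periodNV_free_of_thetaRealisation₂_abs hHD hI h₁ h₃ h) hR

/-- **The ABSTRACT realisation display on the universe OF RECORD — ONE hypothesis** (the four `_holds` data and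
`deligneMilne1982_Thm_6_20_full_holds` plugged in; `let U := U_rec` for legibility).  Per face: `HG`, `emb` [item (iii), abstract], `Θ`
[theta sets], `Siso` [(v-S)], h₂ `inner_emb`, h₅ `Theta_sub`, h₆ wedge, h₇ C5′, h₈ C6′ — the hypothesis list of PKG
`nonempty_thetaRealisation₂_at` (`HodgeCM/Model/EndStateMeet.lean`:353).  `HC_CM` is NOT proved: the hypothesis is open at a general face
(«discharged by record» is the package's, pending the red team's signed equality check). [folklore] -/
theorem hc_cm_of_thetaRealisation₂_abs_rec :
    let U := picardCMUniverse exists_isReal_hodgeModel_holds hodgePQ_independent_of_hodgeModel_holds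
      BallQuotient.ballQuotientUniformised_holds cmAbelianVarietyRealised_holds
    (∀ (F : CMField), IsGalois ℚ F → 6 ≤ Module.finrank ℚ F → ∀ f : Face F,
      ∃ (ι₁ : F →+* ℂ) (V : HermSpace3 F ι₁) (σ : F →+* ℂ)
        (HG : Type) (_ : NormedAddCommGroup HG) (_ : InnerProductSpace ℂ HG) (_ : CompleteSpace HG)
        (emb : ∀ Γ : Level V, U.CohC (U.pms F ι₁ V Γ) 2 →ₗ[ℂ] HG)
        (Θ : Fin 4 → ∀ Γ : Level V, Set (U.CohC (U.pms F ι₁ V Γ) 1))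
        (H CG G SK SigIdx SigIdxG : Type)
        (_ : NormedAddCommGroup H) (_ : InnerProductSpace ℂ H) (_ : CompleteSpace H)
        (_ : NormedAddCommGroup CG) (_ : NormedSpace ℂ CG) (_ : Group G) (_ : TopologicalSpace G) (_ : TopologicalSpace SK)
        (Siso : Perl34.IsolationSetting H HG CG G SK SigIdx SigIdxG),
        (∀ Γ : Level V, ∃ c : ℂ, c ≠ 0 ∧ ∀ x y : U.CohC (U.pms F ι₁ V Γ) 2,
          x ∈ (U.hodge (U.pms F ι₁ V Γ) 2).F 2 → y ∈ (U.hodge (U.pms F ι₁ V Γ) 2).F 2 →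
            ⟪emb Γ y, emb Γ x⟫_ℂ = c * U.trC (U.pms F ι₁ V Γ) 4 (U.cup2C (U.pms F ι₁ V Γ) 2 x (conj y))) ∧
        (∀ (i : Fin 4) (Γ : Level V), Θ i Γ ⊆ U.Uiso Γ F (f.psi i) σ) ∧
        (∃ Γ : Level V, ∃ ω₁ ∈ Θ 0 Γ, ∃ ω₂ ∈ Θ 1 Γ, U.cup2C (U.pms F ι₁ V Γ) 1 ω₁ ω₂ ≠ 0) ∧
        (∀ (Γ : Level V) (ω₁ ω₂ : U.CohC (U.pms F ι₁ V Γ) 1), ω₁ ∈ Θ 0 Γ → ω₂ ∈ Θ 1 Γ →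
          emb Γ (U.cup2C (U.pms F ι₁ V Γ) 1 ω₁ ω₂) ≠ 0 → ∃ u ∈ Siso.t12.S12, ⟪emb Γ (U.cup2C (U.pms F ι₁ V Γ) 1 ω₁ ω₂), u⟫_ℂ ≠ 0) ∧
        (∀ χ : Siso.t34.X, Siso.t34.allowed χ → ∀ (Φ : SK) (Γ₁ : Level V) (ω₁ ω₂ : U.CohC (U.pms F ι₁ V Γ₁) 1),
          ω₁ ∈ U.Uiso Γ₁ F (f.psi 0) σ → ω₂ ∈ U.Uiso Γ₁ F (f.psi 1) σ →
            ⟪emb Γ₁ (U.cup2C (U.pms F ι₁ V Γ₁) 1 ω₁ ω₂), Siso.t34.ϑ χ Φ⟫_ℂ ≠ 0 →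
              ∃ (Γ : Level V) (ω : Fin 4 → U.CohC (U.pms F ι₁ V Γ) 1), (∀ i, ω i ∈ U.Uiso Γ F (f.psi i) σ) ∧
                ⟪emb Γ (U.cup2C (U.pms F ι₁ V Γ) 1 (ω 2) (ω 3)), emb Γ (U.cup2C (U.pms F ι₁ V Γ) 1 (ω 0) (ω 1))⟫_ℂ ≠ 0)) →
    HC_CM :=
  fun h ↦ hc_cm_of_thetaRealisation₂_abs _ _ _ _ deligneMilne1982_Thm_6_20_full_holds h

/-- **The ABSTRACT TWIN of p292271 on the universe OF RECORD — ONE hypothesis**: `Model.hc_cm_of_jointThetaPin_meeting_rec` verbatim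
with item (iii) abstract — per face ∃ `ι₁ V σ`, DATA `S : Transposition.FaceThetaSupply` [theta sets + `Theta_sub` + SUPPLY], `HG`, `emb`,
carriers, `Siso`, and the clauses `inner_emb` ∧ (1) `S.TranslateClosed (heckeFamily …)` ∧ (2′) C5′ `gen12Meet` ∧ (3′) C6′ `real34Meet`.
Reduction to `hc_cm_of_thetaRealisation₂_abs`: `Θ := S.Theta`, h₅ := `S.Theta_sub`, h₆ := `Transposition.Model.wedge_of_translateClosed_heckeFamily S`
(supply + B01-H within the honest Hecke family + translate-closure ⇒ a non-zero cohomological theta (12)-wedge).  `HC_CM` is NOT proved. [folklore] -/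
theorem hc_cm_of_jointThetaPin_meeting_abs_rec :
    let U := picardCMUniverse exists_isReal_hodgeModel_holds hodgePQ_independent_of_hodgeModel_holds
      BallQuotient.ballQuotientUniformised_holds cmAbelianVarietyRealised_holds
    (∀ (F : CMField), IsGalois ℚ F → 6 ≤ Module.finrank ℚ F → ∀ f : Face F,
      ∃ (ι₁ : F →+* ℂ) (V : HermSpace3 F ι₁) (σ : F →+* ℂ)
        (S : FaceThetaSupply U ι₁ V F f.psi σ)
        (HG : Type) (_ : NormedAddCommGroup HG) (_ : InnerProductSpace ℂ HG) (_ : CompleteSpace HG)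
        (emb : ∀ Γ : Level V, U.CohC (U.pms F ι₁ V Γ) 2 →ₗ[ℂ] HG)
        (H CG G SK SigIdx SigIdxG : Type)
        (_ : NormedAddCommGroup H) (_ : InnerProductSpace ℂ H) (_ : CompleteSpace H)
        (_ : NormedAddCommGroup CG) (_ : NormedSpace ℂ CG) (_ : Group G) (_ : TopologicalSpace G) (_ : TopologicalSpace SK)
        (Siso : Perl34.IsolationSetting H HG CG G SK SigIdx SigIdxG),
        (∀ Γ : Level V, ∃ c : ℂ, c ≠ 0 ∧ ∀ x y : U.CohC (U.pms F ι₁ V Γ) 2,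
          x ∈ (U.hodge (U.pms F ι₁ V Γ) 2).F 2 → y ∈ (U.hodge (U.pms F ι₁ V Γ) 2).F 2 →
            ⟪emb Γ y, emb Γ x⟫_ℂ = c * U.trC (U.pms F ι₁ V Γ) 4 (U.cup2C (U.pms F ι₁ V Γ) 2 x (conj y))) ∧
        S.TranslateClosed (Transposition.Model.heckeFamily exists_isReal_hodgeModel_holds hodgePQ_independent_of_hodgeModel_holds
          BallQuotient.ballQuotientUniformised_holds cmAbelianVarietyRealised_holds) ∧
        (∀ (Γ : Level V) (ω₁ ω₂ : U.CohC (U.pms F ι₁ V Γ) 1), ω₁ ∈ S.Theta 0 Γ → ω₂ ∈ S.Theta 1 Γ →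
          emb Γ (U.cup2C (U.pms F ι₁ V Γ) 1 ω₁ ω₂) ≠ 0 → ∃ u ∈ Siso.t12.S12, ⟪emb Γ (U.cup2C (U.pms F ι₁ V Γ) 1 ω₁ ω₂), u⟫_ℂ ≠ 0) ∧
        (∀ χ : Siso.t34.X, Siso.t34.allowed χ → ∀ (Φ : SK) (Γ₁ : Level V) (ω₁ ω₂ : U.CohC (U.pms F ι₁ V Γ₁) 1),
          ω₁ ∈ U.Uiso Γ₁ F (f.psi 0) σ → ω₂ ∈ U.Uiso Γ₁ F (f.psi 1) σ →
            ⟪emb Γ₁ (U.cup2C (U.pms F ι₁ V Γ₁) 1 ω₁ ω₂), Siso.t34.ϑ χ Φ⟫_ℂ ≠ 0 →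
              ∃ (Γ : Level V) (ω : Fin 4 → U.CohC (U.pms F ι₁ V Γ) 1), (∀ i, ω i ∈ U.Uiso Γ F (f.psi i) σ) ∧
                ⟪emb Γ (U.cup2C (U.pms F ι₁ V Γ) 1 (ω 2) (ω 3)), emb Γ (U.cup2C (U.pms F ι₁ V Γ) 1 (ω 0) (ω 1))⟫_ℂ ≠ 0)) →
    HC_CM := by
  intro U h
  refine hc_cm_of_thetaRealisation₂_abs_rec fun F hG h6 f => ?_
  obtain ⟨ι₁, V, σ, S, HG, _, _, _, emb, H, CG, G, SK, SigIdx, SigIdxG, _, _, _, _, _, _, _, _, Siso, hinner, hT, hg, hr⟩ :=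
    h F hG h6 f
  exact ⟨ι₁, V, σ, HG, _, _, _, emb, S.Theta, H, CG, G, SK, SigIdx, SigIdxG, _, _, _, _, _, _, _, _, Siso, hinner, S.Theta_sub,
    Transposition.Model.wedge_of_translateClosed_heckeFamily S hT, hg, hr⟩

#print axioms hc_cm_of_thetaRealisation₂_abs_rec
#print axioms hc_cm_of_jointThetaPin_meeting_abs_rec

end Model

end Summit.HodgeConjecture.CorCM

end
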